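import Literature.MeasureTheory.Group.PadicPolynomialBallVolume
import Mathlib.Topology.Algebra.MvPolynomial
import Mathlib.MeasureTheory.Constructions.Polish.Basic
import Mathlib.MeasureTheory.Measure.WithDensity
import HarnessLib

/-!
# The `p`-adic change-of-variables formula for injective étale polynomial maps of `ℤ_pⁿ`:
# `vol(F(U)) = ∫_U |det J_F(x)|_p dx` and `∫_{F(U)} g = ∫_U g(F(x)) |det J_F(x)|_p dx`

Topic `Literature/MeasureTheory/Group`; continues `PadicPolynomialBallVolume.lean` (for a
polynomial system `F` with `ℤ_p`-coefficients and `0 ≤ r < |det J_F(x₀)|_p`: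
`vol(F(closedBall x₀ r)) = |det J_F(x₀)|_p · vol(closedBall x₀ r)`, `F` injective on the ball).
Everything here is PROVED (no named facts).

* `norm_eval_sub_eval_le` — a polynomial with `ℤ_p`-coefficients is `1`-Lipschitz on `ℤ_pⁿ`;
  `norm_jacobianDet_eq_of_mem_closedBall` — hence `|det J_F|_p` is constant on every closed ball of
  radius `< |det J_F(centre)|_p`.
* `padicInt_pi_volume_image_inter_closedBall` — **local formula**: on such a ball `B`,
  `vol(F(A ∩ B)) = |det J_F(x₀)|_p · vol(A ∩ B)` for every measurable `A` (the two sides are finite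
  measures in `A` agreeing on the π-system of closed balls of radius `≤ r`, which in the
  ultrametric space `ℤ_pⁿ` are pairwise nested or disjoint and generate the Borel σ-algebra).
* `padicInt_pi_volume_image_eq_lintegral` — **`vol(F(U)) = ∫⁻_U |det J_F(x)|_p dx`** for a
  measurable `U ⊆ ℤ_pⁿ` on which `F` is injective and `det J_F ≠ 0` (countable subcover by good
  balls, disjointification, Lusin–Souslin measurability of the injective continuous images).
* `padicInt_pi_volume_image_eq_mul_of_nnnorm_det_eq` — constant Jacobian: `vol(F(A)) = c · vol(A)`.
* `padicInt_pi_lintegral_image_eq` — **`∫⁻_{F(U)} g = ∫⁻_U g(F(x)) |det J_F(x)|_p dx`** for every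
  measurable `g ≥ 0`; `padicInt_pi_map_withDensity_eq` — the underlying identity of measures
  `F_*(|det J_F| · vol|_U) = vol|_{F(U)}`.

This is the change-of-variables theorem for `p`-adic integrals (Igusa, *An introduction to the
theory of local zeta functions*, §7.4; Weil, *Adeles and algebraic groups*, Ch. II §2.2.1) in the
case of polynomial maps with `ℤ_p`-integral coefficients — the "principle of permanence of
identities" step of the `p`-adic volume computations of Bhargava–Shankar, Ann. of Math. 181
(2015), §3.4, Props. 3.11–3.12 (published numbering), reduced to Hensel's lemma and the Smith
normal form.

## References

* J.-I. Igusa, *An introduction to the theory of local zeta functions* (2000), §7.4, Prop. 7.4.1. [folklore]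
* A. Weil, *Adeles and algebraic groups*, Progress in Math. 23 (1982), Ch. II §2.2. [folklore]
* M. Bhargava, A. Shankar, Ann. of Math. (2) 181 (2015) 191–242, §3.4 (published numbering).
  [cite: BhargavaShankarAnnals2015, §3.4 (p-adic change of measure; arXiv:1006.1002v2 §2.4 Prop. 2.8)]
-/

noncomputable section

open MeasureTheory MeasureTheory.Measure Set Metric MvPolynomial Matrix TopologicalSpace
open scoped ENNReal NNReal

namespace Literature.MeasureTheory.Group

variable {p : ℕ} [Fact p.Prime] {ι : Type*} [Fintype ι]

/-! ## §1 Polynomials with `ℤ_p`-coefficients are `1`-Lipschitz; local constancy of `|det J|` -/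

/-- **A polynomial with `ℤ_p`-coefficients is `1`-Lipschitz on `ℤ_pⁿ`**:
`‖P(y) − P(x)‖ ≤ ‖y − x‖`. [folklore] -/
theorem norm_eval_sub_eval_le (P : MvPolynomial ι ℤ_[p]) (x y : ι → ℤ_[p]) :
    ‖eval y P - eval x P‖ ≤ ‖y - x‖ := by
  have hy : y = x + (y - x) := by abel
  have e : eval y P - eval x P = (eval (x + (y - x)) P - eval x P -
      ∑ j, eval x (pderiv j P) * (y - x) j) + ∑ j, eval x (pderiv j P) * (y - x) j := by
    rw [← hy]; abel
  rw [e]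
  refine (IsUltrametricDist.norm_add_le_max _ _).trans (max_le ?_ ?_)
  · calc _ ≤ ‖y - x‖ ^ 2 := Literature.RingTheory.HenselLemma.norm_rem_le P x (y - x)
      _ ≤ ‖y - x‖ := by
          rw [sq]
          exact mul_le_of_le_one_left (norm_nonneg _)
            ((pi_norm_le_iff_of_nonneg zero_le_one).mpr fun i ↦ PadicInt.norm_le_one _)
  · exact Literature.RingTheory.HenselLemma.norm_sum_mul_le _ _

omit [Fintype ι] in
/-- The system `F` as a map `ℤ_pⁿ → ℤ_pⁿ` is continuous (each coordinate by Mathlib's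
`MvPolynomial.continuous_eval`). [folklore] -/
theorem continuous_evalVec (F : ι → MvPolynomial ι ℤ_[p]) :
    Continuous fun x : ι → ℤ_[p] ↦ fun i ↦ eval x (F i) :=
  continuous_pi fun i ↦ MvPolynomial.continuous_eval (F i)

variable [DecidableEq ι]

/-- The Jacobian determinant is the value of the polynomial `det(∂ⱼFᵢ)`. [folklore] -/
theorem jacobianDet_eq_eval (F : ι → MvPolynomial ι ℤ_[p]) (x : ι → ℤ_[p]) :
    (Matrix.of fun i j ↦ eval x (pderiv j (F i))).det =
      eval x (Matrix.of fun i j ↦ pderiv j (F i)).det := by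
  rw [RingHom.map_det]
  congr 1

/-- `x ↦ det J_F(x)` is continuous. [folklore] -/
theorem continuous_jacobianDet (F : ι → MvPolynomial ι ℤ_[p]) :
    Continuous fun x : ι → ℤ_[p] ↦ (Matrix.of fun i j ↦ eval x (pderiv j (F i))).det := by
  simp_rw [jacobianDet_eq_eval]
  exact MvPolynomial.continuous_eval _

/-- `x ↦ |det J_F(x)|_p` (in `ℝ≥0∞`) is measurable. [folklore] -/
theorem measurable_ennnorm_jacobianDet (F : ι → MvPolynomial ι ℤ_[p]) :
    Measurable fun x : ι → ℤ_[p] ↦ (‖(Matrix.of fun i j ↦ eval x (pderiv j (F i))).det‖₊ : ℝ≥0∞) :=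
  (continuous_jacobianDet F).measurable.nnnorm.coe_nnreal_ennreal

/-- **`|det J_F|_p` is constant on small balls**: if `r < |det J_F(x₀)|_p` then
`|det J_F(y)|_p = |det J_F(x₀)|_p` for every `y ∈ closedBall x₀ r`. [folklore] -/
theorem norm_jacobianDet_eq_of_mem_closedBall (F : ι → MvPolynomial ι ℤ_[p]) {x₀ y : ι → ℤ_[p]}
    {r : ℝ} (hrd : r < ‖(Matrix.of fun i j ↦ eval x₀ (pderiv j (F i))).det‖)
    (hy : y ∈ closedBall x₀ r) :
    ‖(Matrix.of fun i j ↦ eval y (pderiv j (F i))).det‖ =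
      ‖(Matrix.of fun i j ↦ eval x₀ (pderiv j (F i))).det‖ := by
  rw [jacobianDet_eq_eval, jacobianDet_eq_eval] at *
  set D := (Matrix.of fun i j ↦ pderiv j (F i)).det
  have hyx : ‖y - x₀‖ ≤ r := by rw [← dist_eq_norm]; exact mem_closedBall.mp hy
  have hlt : ‖eval y D - eval x₀ D‖ < ‖eval x₀ D‖ :=
    lt_of_le_of_lt ((norm_eval_sub_eval_le D x₀ y).trans hyx) hrd
  -- ultrametric: `‖a‖ ≤ max ‖a-b‖ ‖b‖ = ‖b‖` and `‖b‖ ≤ max ‖b-a‖ ‖a‖`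
  apply le_antisymm
  · calc ‖eval y D‖ = ‖(eval y D - eval x₀ D) + eval x₀ D‖ := by rw [sub_add_cancel]
      _ ≤ max ‖eval y D - eval x₀ D‖ ‖eval x₀ D‖ := IsUltrametricDist.norm_add_le_max _ _
      _ = ‖eval x₀ D‖ := max_eq_right hlt.le
  · by_contra hlt'
    push Not at hlt'
    have : ‖eval x₀ D‖ ≤ max ‖eval x₀ D - eval y D‖ ‖eval y D‖ := by
      calc ‖eval x₀ D‖ = ‖(eval x₀ D - eval y D) + eval y D‖ := by rw [sub_add_cancel]
        _ ≤ _ := IsUltrametricDist.norm_add_le_max _ _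
    rw [norm_sub_rev] at this
    rcases le_max_iff.mp this with h1 | h1
    · exact absurd h1 (not_le.mpr hlt)
    · exact absurd h1 (not_le.mpr hlt')

/-! ## §2 The π-system of small closed balls -/

omit [DecidableEq ι] in
/-- Closed balls of radius in `(0, r]` in `ℤ_pⁿ`, together with `∅`, form a π-system: two such balls
are nested or disjoint (ultrametric trichotomy). [folklore] -/
theorem isPiSystem_closedBalls (r : ℝ) :
    IsPiSystem {S : Set (ι → ℤ_[p]) | S = ∅ ∨ ∃ y : ι → ℤ_[p], ∃ s : ℝ, 0 < s ∧ s ≤ r ∧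
      S = closedBall y s} := by
  rintro S hS T hT hne
  rcases hS with rfl | ⟨y, s, hs0, hsr, rfl⟩
  · rw [empty_inter] at hne; exact absurd hne not_nonempty_empty
  rcases hT with rfl | ⟨y', s', hs0', hsr', rfl⟩
  · rw [inter_empty] at hne; exact absurd hne not_nonempty_empty
  rcases IsUltrametricDist.closedBall_subset_trichotomy (x := y) (r := s) (y := y') (s := s') with
    h | h | h
  · exact Or.inr ⟨y, s, hs0, hsr, inter_eq_left.mpr h⟩
  · exact Or.inr ⟨y', s', hs0', hsr', inter_eq_right.mpr h⟩
  · rw [h.inter_eq] at hne; exact absurd hne not_nonempty_empty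

omit [DecidableEq ι] in
/-- These balls form a basis of the topology of `ℤ_pⁿ` (closed balls of positive radius are open in
an ultrametric space), hence generate the Borel σ-algebra. [folklore] -/
theorem borel_eq_generateFrom_closedBalls {r : ℝ} (hr : 0 < r) :
    borel (ι → ℤ_[p]) = MeasurableSpace.generateFrom {S : Set (ι → ℤ_[p]) | S = ∅ ∨
      ∃ y : ι → ℤ_[p], ∃ s : ℝ, 0 < s ∧ s ≤ r ∧ S = closedBall y s} := by
  apply IsTopologicalBasis.borel_eq_generateFrom
  apply isTopologicalBasis_of_isOpen_of_nhds
  · rintro S (rfl | ⟨y, s, hs0, -, rfl⟩)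
    · exact isOpen_empty
    · exact IsUltrametricDist.isOpen_closedBall (x := y) hs0.ne'
  · intro a U haU hU
    obtain ⟨ε, hε, hball⟩ := Metric.isOpen_iff.mp hU a haU
    have hm : 0 < min (ε / 2) r := lt_min (half_pos hε) hr
    refine ⟨closedBall a (min (ε / 2) r), Or.inr ⟨a, _, hm, min_le_right _ _, rfl⟩,
      mem_closedBall_self hm.le, ?_⟩
    exact (closedBall_subset_ball (lt_of_le_of_lt (min_le_left _ _) (half_lt_self hε))).trans hball

/-! ## §3 The local formula on a good ball -/

/-- **Local change of variables.** Let `J = (∂ⱼFᵢ(x₀))` have `det J ≠ 0` and `0 < r < |det J|_p`,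
`B = closedBall x₀ r`. Then for every measurable `A ⊆ ℤ_pⁿ`,
`vol(F(A ∩ B)) = |det J|_p · vol(A ∩ B)`: both sides are finite measures in `A` which agree on the
π-system of closed balls of radius `≤ r` (a ball inside `B` is handled by
`padicInt_pi_volume_image_eval_closedBall` at its own centre, `|det J_F|_p` being constant on `B`;
a ball containing `B`, or disjoint from `B`, trivially), hence everywhere. [folklore] -/
theorem padicInt_pi_volume_image_inter_closedBall (F : ι → MvPolynomial ι ℤ_[p]) (x₀ : ι → ℤ_[p])
    (hd : (Matrix.of fun i j ↦ eval x₀ (pderiv j (F i))).det ≠ 0) {r : ℝ} (hr : 0 < r)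
    (hrd : r < ‖(Matrix.of fun i j ↦ eval x₀ (pderiv j (F i))).det‖) {A : Set (ι → ℤ_[p])}
    (hA : MeasurableSet A) :
    volume ((fun x : ι → ℤ_[p] ↦ fun i ↦ eval x (F i)) '' (A ∩ closedBall x₀ r)) =
      (‖(Matrix.of fun i j ↦ eval x₀ (pderiv j (F i))).det‖₊ : ℝ≥0∞) *
        volume (A ∩ closedBall x₀ r) := by
  set Fv : (ι → ℤ_[p]) → (ι → ℤ_[p]) := fun x i ↦ eval x (F i) with hFv
  set B := closedBall x₀ r with hB
  set c : ℝ≥0∞ := ((‖(Matrix.of fun i j ↦ eval x₀ (pderiv j (F i))).det‖₊ : ℝ≥0) : ℝ≥0∞) with hc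
  -- `F|_B` is a closed embedding of the compact ball
  haveI : CompactSpace B := isCompact_iff_compactSpace.mp isClosed_closedBall.isCompact
  let e : B → (ι → ℤ_[p]) := fun z ↦ Fv z
  have he_cont : Continuous e := (continuous_evalVec F).comp continuous_subtype_val
  have he_inj : Function.Injective e := fun z w h ↦
    Subtype.ext (padicInt_pi_injOn_eval_closedBall F x₀ hd hr.le hrd z.2 w.2 h)
  have hemb : MeasurableEmbedding e := (he_cont.isClosedEmbedding he_inj).measurableEmbedding
  -- the two measures
  set μ₁ : Measure (ι → ℤ_[p]) := (Measure.comap e volume).map Subtype.val with hμ₁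
  set μ₂ : Measure (ι → ℤ_[p]) := c • volume.restrict B with hμ₂
  have hμ₁_apply : ∀ {S : Set (ι → ℤ_[p])}, MeasurableSet S → μ₁ S = volume (Fv '' (S ∩ B)) := by
    intro S hS
    rw [hμ₁, Measure.map_apply measurable_subtype_coe hS, hemb.comap_apply,
      show e = Fv ∘ Subtype.val from rfl, image_comp, Subtype.image_preimage_coe, inter_comm]
  have hμ₂_apply : ∀ {S : Set (ι → ℤ_[p])}, MeasurableSet S → μ₂ S = c * volume (S ∩ B) := by
    intro S hS
    rw [hμ₂, Measure.smul_apply, Measure.restrict_apply hS, smul_eq_mul]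
  -- balls of radius `≤ r` inside `B`
  have hball : ∀ (y : ι → ℤ_[p]) (s : ℝ), 0 ≤ s → s ≤ r → closedBall y s ⊆ B →
      volume (Fv '' closedBall y s) = c * volume (closedBall y s) := by
    intro y s hs hsr hsub
    have hyB : y ∈ B := hsub (mem_closedBall_self hs)
    have hnorm := norm_jacobianDet_eq_of_mem_closedBall F hrd hyB
    have hdy : (Matrix.of fun i j ↦ eval y (pderiv j (F i))).det ≠ 0 := by
      rw [← norm_pos_iff, hnorm]; exact norm_pos_iff.mpr hd
    have hsd : s < ‖(Matrix.of fun i j ↦ eval y (pderiv j (F i))).det‖ := by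
      rw [hnorm]; exact lt_of_le_of_lt hsr hrd
    rw [padicInt_pi_volume_image_eval_closedBall F y hdy hs hsd, hc]
    congr 2
    exact NNReal.eq hnorm
  -- the measures agree
  have hgen := (BorelSpace.measurable_eq (α := ι → ℤ_[p])).trans
    (borel_eq_generateFrom_closedBalls (p := p) (ι := ι) hr)
  haveI : IsFiniteMeasure μ₁ := ⟨by rw [hμ₁_apply MeasurableSet.univ]; exact measure_lt_top _ _⟩
  have hμ : μ₁ = μ₂ := by
    refine ext_of_generate_finite _ hgen (isPiSystem_closedBalls r) ?_ ?_
    · rintro S (rfl | ⟨y, s, hs0, hsr, rfl⟩)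
      · simp
      · rw [hμ₁_apply measurableSet_closedBall, hμ₂_apply measurableSet_closedBall]
        rcases IsUltrametricDist.closedBall_subset_trichotomy (x := y) (r := s) (y := x₀) (s := r)
          with h | h | h
        · rw [inter_eq_left.mpr h, hball y s hs0.le hsr h]
        · rw [inter_eq_right.mpr h, hball x₀ r hr.le le_rfl subset_rfl]
        · rw [h.inter_eq, image_empty, measure_empty, mul_zero]
    · rw [hμ₁_apply MeasurableSet.univ, hμ₂_apply MeasurableSet.univ, univ_inter,
        hball x₀ r hr.le le_rfl subset_rfl]
  have hAe : μ₁ A = μ₂ A := by rw [hμ]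
  rwa [hμ₁_apply hA, hμ₂_apply hA] at hAe

/-! ## §4 The global formula `vol(F(U)) = ∫_U |det J_F|` -/

/-- **`p`-adic change of variables, set form.** Let `F = (F₁,…,Fₙ)` be polynomials in `n` variables
with `ℤ_p`-coefficients, `U ⊆ ℤ_pⁿ` measurable, `F` injective on `U` and `det J_F(x) ≠ 0` for all
`x ∈ U`. Then `vol(F(U)) = ∫⁻_{U} |det J_F(x)|_p dx`. [folklore] -/
theorem padicInt_pi_volume_image_eq_lintegral (F : ι → MvPolynomial ι ℤ_[p]) {U : Set (ι → ℤ_[p])}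
    (hU : MeasurableSet U) (hinj : InjOn (fun x : ι → ℤ_[p] ↦ fun i ↦ eval x (F i)) U)
    (hdet : ∀ x ∈ U, (Matrix.of fun i j ↦ eval x (pderiv j (F i))).det ≠ 0) :
    volume ((fun x : ι → ℤ_[p] ↦ fun i ↦ eval x (F i)) '' U) =
      ∫⁻ x in U, (‖(Matrix.of fun i j ↦ eval x (pderiv j (F i))).det‖₊ : ℝ≥0∞) := by
  set Fv : (ι → ℤ_[p]) → (ι → ℤ_[p]) := fun x i ↦ eval x (F i) with hFv
  set dJ : (ι → ℤ_[p]) → ℤ_[p] := fun x ↦ (Matrix.of fun i j ↦ eval x (pderiv j (F i))).det with hdJ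
  have hp1 : (1 : ℝ) < p := by exact_mod_cast (Fact.out : p.Prime).one_lt
  -- radii of the good balls
  set ρ : (ι → ℤ_[p]) → ℝ := fun x ↦ ‖dJ x‖ / p with hρ
  have hρpos : ∀ x ∈ U, 0 < ρ x := fun x hx ↦
    div_pos (norm_pos_iff.mpr (hdet x hx)) (zero_lt_one.trans hp1)
  have hρlt : ∀ x ∈ U, ρ x < ‖dJ x‖ := fun x hx ↦
    div_lt_self (norm_pos_iff.mpr (hdet x hx)) hp1
  rcases U.eq_empty_or_nonempty with rfl | hne
  · simp
  -- a countable subcover of `U` by good balls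
  obtain ⟨T, hTU, hTc, hTcover⟩ := isOpen_biUnion_countable U (fun x ↦ closedBall x (ρ x))
    (fun x hx ↦ IsUltrametricDist.isOpen_closedBall (x := x) (hρpos x hx).ne')
  have hUsub : U ⊆ ⋃ x ∈ T, closedBall x (ρ x) := by
    rw [hTcover]
    exact fun x hx ↦ mem_biUnion hx (mem_closedBall_self (hρpos x hx).le)
  have hTne : T.Nonempty := by
    obtain ⟨x, hx⟩ := hne
    obtain ⟨y, hy, -⟩ := mem_iUnion₂.mp (hUsub hx)
    exact ⟨y, hy⟩
  obtain ⟨t, ht⟩ := hTc.exists_eq_range hTne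
  have htU : ∀ n, t n ∈ U := fun n ↦ hTU (ht ▸ mem_range_self n)
  -- the pieces
  set G : ℕ → Set (ι → ℤ_[p]) := fun n ↦ closedBall (t n) (ρ (t n)) with hG
  set A : ℕ → Set (ι → ℤ_[p]) := fun n ↦ U ∩ disjointed G n with hA
  have hGmeas : ∀ n, MeasurableSet (G n) := fun n ↦ measurableSet_closedBall
  have hAmeas : ∀ n, MeasurableSet (A n) := fun n ↦ hU.inter (MeasurableSet.disjointed hGmeas n)
  have hAG : ∀ n, A n ⊆ G n := fun n ↦ inter_subset_right.trans (disjointed_subset G n)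
  have hAU' : ∀ n, A n ⊆ U := fun n ↦ inter_subset_left
  have hAU : ⋃ n, A n = U := by
    rw [hA]
    simp only [← inter_iUnion, iUnion_disjointed]
    refine inter_eq_left.mpr ?_
    intro x hx
    obtain ⟨y, hy, hxy⟩ := mem_iUnion₂.mp (hUsub hx)
    rw [ht] at hy
    obtain ⟨n, rfl⟩ := hy
    exact mem_iUnion.mpr ⟨n, hxy⟩
  have hdisj : Pairwise (Function.onFun Disjoint A) := fun m n hmn ↦
    (disjoint_disjointed G hmn).mono inter_subset_right inter_subset_right
  -- the images of the pieces are measurable and disjoint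
  have himg_meas : ∀ n, MeasurableSet (Fv '' A n) := fun n ↦
    (hAmeas n).image_of_continuousOn_injOn (continuous_evalVec F).continuousOn (hinj.mono (hAU' n))
  have himg_disj : Pairwise (Function.onFun Disjoint fun n ↦ Fv '' A n) := by
    intro m n hmn
    refine disjoint_left.mpr ?_
    rintro _ ⟨a, ha, rfl⟩ ⟨b, hb, hab⟩
    have : b = a := hinj (hAU' n hb) (hAU' m ha) hab
    subst this
    exact disjoint_left.mp (hdisj hmn) ha hb
  -- on each piece `|det J|` is the constant `‖dJ (t n)‖`
  have hconst : ∀ n, ∀ x ∈ A n, ‖dJ x‖ = ‖dJ (t n)‖ := fun n x hx ↦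
    norm_jacobianDet_eq_of_mem_closedBall F (hρlt (t n) (htU n)) (hAG n hx)
  have hpiece : ∀ n, volume (Fv '' A n) = (‖dJ (t n)‖₊ : ℝ≥0∞) * volume (A n) := by
    intro n
    have h := padicInt_pi_volume_image_inter_closedBall F (t n) (hdet _ (htU n)) (hρpos _ (htU n))
      (hρlt _ (htU n)) (hAmeas n)
    rwa [inter_eq_left.mpr (hAG n)] at h
  calc volume (Fv '' U) = volume (⋃ n, Fv '' A n) := by rw [← image_iUnion, hAU]
    _ = ∑' n, volume (Fv '' A n) := measure_iUnion himg_disj himg_meas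
    _ = ∑' n, ∫⁻ x in A n, (‖dJ x‖₊ : ℝ≥0∞) := by
        refine tsum_congr fun n ↦ ?_
        rw [hpiece n, ← setLIntegral_const]
        refine setLIntegral_congr_fun (hAmeas n) fun x hx ↦ ?_
        rw [show ‖dJ x‖₊ = ‖dJ (t n)‖₊ from NNReal.eq (hconst n x hx)]
    _ = ∫⁻ x in ⋃ n, A n, (‖dJ x‖₊ : ℝ≥0∞) := (lintegral_iUnion hAmeas hdisj _).symm
    _ = ∫⁻ x in U, (‖dJ x‖₊ : ℝ≥0∞) := by rw [hAU]

/-- **Constant Jacobian.** If moreover `|det J_F(x)|_p = c` for all `x ∈ U`, then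
`vol(F(A)) = c · vol(A)` for every measurable `A ⊆ U` (the case of the maps with constant Jacobian
of Bhargava–Shankar's `p`-adic volume computations). [folklore] -/
theorem padicInt_pi_volume_image_eq_mul_of_nnnorm_det_eq (F : ι → MvPolynomial ι ℤ_[p])
    {U : Set (ι → ℤ_[p])} (hinj : InjOn (fun x : ι → ℤ_[p] ↦ fun i ↦ eval x (F i)) U)
    (hdet : ∀ x ∈ U, (Matrix.of fun i j ↦ eval x (pderiv j (F i))).det ≠ 0) {c : ℝ≥0}
    (hc : ∀ x ∈ U, ‖(Matrix.of fun i j ↦ eval x (pderiv j (F i))).det‖₊ = c)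
    {A : Set (ι → ℤ_[p])} (hA : MeasurableSet A) (hAU : A ⊆ U) :
    volume ((fun x : ι → ℤ_[p] ↦ fun i ↦ eval x (F i)) '' A) = (c : ℝ≥0∞) * volume A := by
  rw [padicInt_pi_volume_image_eq_lintegral F hA (hinj.mono hAU) (fun x hx ↦ hdet x (hAU hx)),
    ← setLIntegral_const]
  exact setLIntegral_congr_fun hA fun x hx ↦ by rw [hc x (hAU hx)]

/-! ## §5 The change-of-variables formula for integrals -/

/-- **The identity of measures** `F_*(|det J_F| · vol|_U) = vol|_{F(U)}` for `U` measurable, `F`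
injective on `U` with `det J_F ≠ 0` on `U`. [folklore] -/
theorem padicInt_pi_map_withDensity_eq (F : ι → MvPolynomial ι ℤ_[p]) {U : Set (ι → ℤ_[p])}
    (hU : MeasurableSet U) (hinj : InjOn (fun x : ι → ℤ_[p] ↦ fun i ↦ eval x (F i)) U)
    (hdet : ∀ x ∈ U, (Matrix.of fun i j ↦ eval x (pderiv j (F i))).det ≠ 0) :
    Measure.map (fun x : ι → ℤ_[p] ↦ fun i ↦ eval x (F i))
        ((volume.restrict U).withDensity fun x ↦
          (‖(Matrix.of fun i j ↦ eval x (pderiv j (F i))).det‖₊ : ℝ≥0∞)) =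
      volume.restrict ((fun x : ι → ℤ_[p] ↦ fun i ↦ eval x (F i)) '' U) := by
  have hFm : Measurable (fun x : ι → ℤ_[p] ↦ fun i ↦ eval x (F i)) := (continuous_evalVec F).measurable
  ext E hE
  rw [Measure.map_apply hFm hE, withDensity_apply _ (hFm hE), Measure.restrict_restrict (hFm hE),
    Measure.restrict_apply hE, ← image_preimage_inter]
  exact (padicInt_pi_volume_image_eq_lintegral F ((hFm hE).inter hU) (hinj.mono inter_subset_right)
    (fun x hx ↦ hdet x hx.2)).symm

/-- **`p`-adic change of variables, integral form.** Let `F = (F₁,…,Fₙ)` be polynomials in `n`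
variables with `ℤ_p`-coefficients, `U ⊆ ℤ_pⁿ` measurable, `F` injective on `U` and `det J_F(x) ≠ 0`
for all `x ∈ U`. Then for every measurable `g : ℤ_pⁿ → [0, ∞]`,
`∫⁻_{F(U)} g(y) dy = ∫⁻_{U} g(F(x)) |det J_F(x)|_p dx` (Igusa, *An introduction to the theory of
local zeta functions*, Prop. 7.4.1, for polynomial maps). [folklore] -/
theorem padicInt_pi_lintegral_image_eq (F : ι → MvPolynomial ι ℤ_[p]) {U : Set (ι → ℤ_[p])}
    (hU : MeasurableSet U) (hinj : InjOn (fun x : ι → ℤ_[p] ↦ fun i ↦ eval x (F i)) U)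
    (hdet : ∀ x ∈ U, (Matrix.of fun i j ↦ eval x (pderiv j (F i))).det ≠ 0)
    {g : (ι → ℤ_[p]) → ℝ≥0∞} (hg : Measurable g) :
    ∫⁻ y in (fun x : ι → ℤ_[p] ↦ fun i ↦ eval x (F i)) '' U, g y =
      ∫⁻ x in U, g (fun i ↦ eval x (F i)) *
        (‖(Matrix.of fun i j ↦ eval x (pderiv j (F i))).det‖₊ : ℝ≥0∞) := by
  have hFm : Measurable (fun x : ι → ℤ_[p] ↦ fun i ↦ eval x (F i)) := (continuous_evalVec F).measurable
  rw [← padicInt_pi_map_withDensity_eq F hU hinj hdet, lintegral_map hg hFm,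
    lintegral_withDensity_eq_lintegral_mul _ (measurable_ennnorm_jacobianDet F)
      (show Measurable (fun a : ι → ℤ_[p] ↦ g (fun i ↦ eval a (F i))) from hg.comp hFm)]
  refine lintegral_congr fun x ↦ ?_
  simp only [Pi.mul_apply, mul_comm]

end Literature.MeasureTheory.Group

end
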